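import Summits.Schanuel.Schanuel.Theorems.RootDecomp1KSuperellipticSiegel02

/-!
# RootDecomp1KSuperellipticSiegel — lens 1, generation 63, NODE 24 «SUPERELLIPTIC SIEGEL ON THE K-LINE — the lacunary dominant-far sector» (the superelliptic Siegel–LeVeque theorem y^m = f(x), m ≥ 3, f with two simple roots, over any number field — PROVED from the tree's unit equation via the cyclotomic–Kummer tower and Siegel's identity; the engine on DOMINANT LACUNARY pairs c_k(Y)·x^k + c₀(Y), k ≥ 3 ⇒ SiegelClause / LevelFinite / ThinFibreAt ∀ m₀ / BddLevelEmpty, intrinsically the class DomSuper P; the genus-six family T j := x³ − (Y⁷ + (4j+2)Y − (4j+2)) decided hypothesis-free ∀ j ∈ ℤ; the territory T_territory incl. 2-adic liveness by size at m₀ = 2; CLAIM L2927, PRICE L2930, K-R55) — continuation (RootDecomp1KSuperellipticSiegel03): §E the engine on dominant lacunary pairs of x-degree k ≥ 3 (the _lac chain, def DomSuper, presentation lemmas, the doors, disjointness) (section Engine)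

(lens-1 g63 NODE 24 «SUPERELLIPTIC SIEGEL ON THE K-LINE — the LACUNARY DOMINANT-FAR SECTOR» L2940/L2941: HOME kernel K = HOME/decomp-schanuel-lens-1/g63/lean/SuperellipticSiegel.lean sha256 f78e5b9a…, 1410 l, ONE namespace `Summit.Schanuel.Schanuel.Theorems.RootDecomp1KSuperellipticSiegel`, imports the tree port …RootDecomp1KHyperellipticSiegel05 ONLY (node 23's part 01 carries the PROVED Literature modules SiegelCubicReduction / UnitEquationFinite / SIntegersFiniteExtension; no …Proofs umbrella, no fact file); no private, no instance, no set_option, no notation, no sorry, no decide; CLAIM L2927, census LIVENESS-v29 (rows T 0 / T 17 tabled on request, OF RECORD L2931 with the critic's territory certificate; keys domSuper / ladder / superell / galtop), crit g12 PRICE L2930 (PAYABLE THEOREM ×1 EX ANTE for (L)+(E)+(F)+(T) jointly under RULE K-R54 (iii) — the superelliptic grade, the LAST credit on the integral-points lane; CHECKLIST K-g63 (1)–(11); RULE K-R55 PRE-ANNOUNCED), writer g33 NOTE 8 L2928 (pre-check 16/16), critic VERDICT: CLEARED — THEOREM ×1 for (L)+(E)+(F)+(T) JOINTLY, ONE credit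 (RULE K-R54 (iii), the superelliptic grade — the LAST credit on the integral-points lane), VERDICT L2943 (crit-1 g12, 2026-09-01T23:12Z): CHECKLIST K-g63 (1)–(11) met item by item on the critic's own farm runs (K rc 0 · 0 errors · 0 sorries; Probe rc 0 with 253 `#print axioms` guards ⊆ the standard triple; Ctrl0 rc 0; Ctrl rc 1 = exactly the 53 planted errors; L_standalone rc 0 ⇒ §L is K-line-independent modulo node 23's Literature-only part 01); TALLY lens-1 ×21 + THEOREM ×23; RULE K-R55 FIXED ((i) toolkit ∪= superelliptic integral-point Siegel — THE INTEGRAL-POINTS LANE IS CLOSED; (ii) open territory at m₀ = 2 := K-R54 (ii) territory not reached by (i): NON-DOMINANT (standing witness W4) and DOMINANT-FAR NON-LACUNARY (standing witness X3); (iii) payable clause; (iv) unconditional part ∪= the node-24 tree names after the port); PORT GO L2944 exactly as census STAGING NOTE 15 L2942 (six parts; the two docstring-preserving boundary moves approved; no privatisation). Port by census-1 gen 24 per NODE-g63.md §(11) as `RootDecomp1KSuperellipticSiegel01–06` (`--supports stmt-Schanuel-33364`; the item stays OPEN; no census credit): 01 = §L floors (section Local: the m-divisibility lemma `natCast_dvd_log_map_sub_of_pow_eq_mul_prod`,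 Siegel's factors / identity / ratio `geomSum_mul_sub_eq` / `map_sub_mul_eq_one` / `siegel_identity_pow` / `eq_of_ratio`; the cyclotomic + Kummer tower `exists_numberField_forall_mem_selmerGroup_isPow` / `exists_numberField_forall_isPow_of_dvd`; bad places `exists_finite_places`); 02 = §L main theorem `finite_integer_pow_eq_of_unitEquation` (U-binder verbatim as the tree's cubic case) + `finite_integer_pow_eq` (unconditional by `finite_unitEquation`) + `finite_integer_pow_eq_of_separable`; 03 = §E the engine on dominant LACUNARY pairs of x-degree k ≥ 3 (the `_lac` chain over node 23's `den_dvd_of_dyadic`, `def DomSuper`, `domSuper_xPolyP_iff` / `domSuper_twoTermP_iff`, the doors `siegelClause_of_domSuper` / `levelFinite_of_domSuper` / `thinFibreAt_of_domSuper` / `bddLevelEmpty_of_domSuper`, disjointness `not_domHyper_of_domSuper` / `not_domSuper_*`) (section Engine); 04 = §F the family `A j`, `tC`, `T j` (`T_eq_twoTermP`), `isEisensteinAt_A` ⇒ `domSuper_T` ⇒ `levelFinite_T` / `thinFibreAt_T` / `siegelClause_T` / … (section Family); 05 = §T part 1 (coefficient read-backs, shape refusals, the deciders' negations, GaussAt 3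 and the ladder at 3, the anchor (1, 1), the odd-prime sieves refused, real liveness) (section Territory, to be continued); 06 = §T part 2 ((T-2) `den_pow_seven_le_T` / `den_pow_lt_T` / `not_thin_ineq_two_T`, `thinFibreAt_two_iff_levelFinite_T`, `T_territory`, `T'` with `T'_zero` / `T'_one` / `T'_territory`) (section Territory re-opened with K's own open-lines). Literature / node-23 twins are CITED by name, never restated. Text = K VERBATIM (every declaration documented by the lens; statements and proofs unchanged; K's module docstring kept in part 01 below this provenance block).)
-/

noncomputable section

namespace Summit.Schanuel.Schanuel.Theorems.RootDecomp1KSuperellipticSiegel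

open Polynomial IsDedekindDomain NumberField
open scoped Classical WithZero
open Literature.NumberTheory.DiophantineGeometry (finite_unitEquation exists_finite_forall_mem_integer_algebraMap
  valuation_algebraMap_eq_one_of_mem_integer_inv valuation_eq_one_of_mul_eq_one)
open IsDedekindDomain.HeightOneSpectrum (setOf_valuation_ne_one_finite setOf_one_lt_valuation_finite)
open Summit.Schanuel.Schanuel.Theorems.RootDecomp1KHyperellipticSiegel (setOf_ne_and_valuation_sub_ne_one_finite)

/-! ### §E  THE ENGINE ON THE K-LINE: DOMINANT LACUNARY PAIRS OF `x`-DEGREE `k ≥ 3` — `c_k(Y)·x^k + c₀(Y)`,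
`deg c_k < deg c₀`, `c₀` SEPARABLE of degree `≥ 2` and COPRIME to `c_k` over `ℚ` — NO SLOPE CONDITION, NO ROOT
CONDITION, NO LOCAL DATUM: at a rational point `(ξ, r)` with dyadic `ξ`, `y := ξ·c_k(r)` satisfies the SUPERELLIPTIC
equation `y^k = −c₀(r)·c_k(r)^{k−1}` over the `T(lc c₀)`-integers of `ℚ`, and §L (PROVED) leaves finitely many `r`. -/

section Engine

open LiouvilleNumber
open scoped Nat
open Summit.Schanuel.Schanuel.Theorems.RootDecomp1KDegreeLadder
open Summit.Schanuel.Schanuel.Theorems.RootDecomp1KXLinear (aeval_ratCast)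
open Summit.Schanuel.Schanuel.Theorems.RootDecomp1KXTop
open Summit.Schanuel.Schanuel.Theorems.RootDecomp1KXAll
open Summit.Schanuel.Schanuel.Theorems.RootDecomp1KLevelFinite
open Summit.Schanuel.Schanuel.Theorems.RootDecomp1KIntegrality (DomZero)
open Summit.Schanuel.Schanuel.Theorems.RootDecomp1KHeightGrading (BddLevelEmpty bddLevelEmpty_iff_levelFinite)
open Summit.Schanuel.Schanuel.Theorems.RootDecomp1KHyperellipticSiegel (den_dvd_of_dyadic badT badT_finite
  valuation_le_one_of_den_dvd val_eq_one_of_not_mem_badT ne_zero_of_domZero DomHyper)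

/-- **LACUNARITY**: with `c_j = 0` for `0 < j < k`, `Σ_{j ≤ k} x^j c_j(y) = c₀(y) + x^k c_k(y)` (any commutative ring). -/
theorem sum_range_lac {R : Type*} [CommRing R] (k : ℕ) (c : ℕ → ℤ[X]) (hk : 1 ≤ k)
    (hlac : ∀ j, 1 ≤ j → j < k → c j = 0) (x y : R) :
    ∑ j ∈ Finset.range (k + 1), x ^ j * aeval y (c j) = aeval y (c 0) + x ^ k * aeval y (c k) := by
  rw [Finset.sum_range_succ, Finset.sum_eq_single 0 (fun j hj hj0 => ?_) (fun h => ?_)]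
  · rw [pow_zero, one_mul]
  · rw [hlac j (Nat.one_le_iff_ne_zero.mpr hj0) (Finset.mem_range.mp hj), map_zero, mul_zero]
  · exact absurd (Finset.mem_range.mpr (by omega)) h

/-- `bev (xPolyP k c) x y = c₀(y) + x^k·c_k(y)` on a lacunary pair. -/
theorem bev_xPolyP_lac (k : ℕ) (c : ℕ → ℤ[X]) (hk : 1 ≤ k) (hlac : ∀ j, 1 ≤ j → j < k → c j = 0) (x y : ℝ) :
    bev (xPolyP k c) x y = aeval y (c 0) + x ^ k * aeval y (c k) := by
  rw [bev_xPolyP, sum_range_lac k c hk hlac]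

/-- the RATIONAL identity at a rational point of a lacunary `xPolyP k c`: `c₀(r) + ξ^k c_k(r) = 0`. -/
theorem ratEq_of_bev_lac {k : ℕ} {c : ℕ → ℤ[X]} (hk : 1 ≤ k) (hlac : ∀ j, 1 ≤ j → j < k → c j = 0) {ξ r : ℚ}
    (h : bev (xPolyP k c) ξ r = 0) : aeval r (c 0) + ξ ^ k * aeval r (c k) = 0 := by
  have h1 : (((aeval r (c 0) + ξ ^ k * aeval r (c k) : ℚ)) : ℝ) = bev (xPolyP k c) ξ r := by
    rw [bev_xPolyP_lac k c hk hlac]; push_cast; rw [aeval_ratCast (c 0) r, aeval_ratCast (c k) r]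
  exact_mod_cast h1.trans h

/-- **ORDINATES OVER DYADIC ABSCISSAE ARE `T(lc c₀)`-INTEGRAL** on a dominant lacunary pair of `x`-degree `k`
(node 23's `den_dvd_of_dyadic`, BY NAME: `den r ∣ 2^{kt}·lc(c₀)`). -/
theorem ordinate_mem_integer_lac {k : ℕ} {c : ℕ → ℤ[X]} (hk : 1 ≤ k) (hlac : ∀ j, 1 ≤ j → j < k → c j = 0)
    (hdom : DomZero k c) {ξ r : ℚ} (hξ : IsDyadic ξ) (h : aeval r (c 0) + ξ ^ k * aeval r (c k) = 0) :
    r ∈ (badT (c 0).leadingCoeff).integer ℚ := by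
  obtain ⟨t, ht⟩ := hξ
  have hsum : ∑ j ∈ Finset.range (k + 1), ξ ^ j * aeval r (c j) = 0 := by rw [sum_range_lac k c hk hlac, h]
  have hdvd := den_dvd_of_dyadic k c hdom (ne_zero_of_domZero hk hdom) ht hsum
  intro v hv
  obtain ⟨h2, hm⟩ := val_eq_one_of_not_mem_badT hv
  refine valuation_le_one_of_den_dvd v ?_ hdvd
  push_cast
  rw [map_mul, map_pow, h2, hm, one_pow, one_mul]

/-- **THE SUPERELLIPTIC EQUATION AT A RATIONAL POINT**: `c₀(r) + ξ^k c_k(r) = 0` gives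
`(ξ·c_k(r))^k = (c₀ · (−c_k^{k−1}))(r)` — multiply by `c_k(r)^{k−1}`. -/
theorem pow_eq_eval_lac {k : ℕ} {c : ℕ → ℤ[X]} (hk : 1 ≤ k) {ξ r : ℚ}
    (h : aeval r (c 0) + ξ ^ k * aeval r (c k) = 0) :
    (ξ * aeval r (c k)) ^ k =
      ((c 0).map (Int.castRingHom ℚ) * -((c k).map (Int.castRingHom ℚ)) ^ (k - 1)).eval r := by
  have hk0 : k ≠ 0 := by omega
  have hξk : ξ ^ k * aeval r (c k) = -aeval r (c 0) := by linear_combination h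
  rw [eval_mul, eval_neg, eval_pow, eval_map, eval_map, ← algebraMap_int_eq, ← aeval_def, ← aeval_def, mul_pow,
    ← mul_pow_sub_one hk0 (aeval r (c k)), ← mul_assoc, hξk]
  ring

/-- **COPRIMALITY EXCLUDES A DEGENERATE FIBRE**: `c₀(r)` and `c_k(r)` do not both vanish, so the fibre polynomial
`c_k(r)·x^k + c₀(r)` in `x` is non-zero (`k ≥ 1`). -/
theorem fibrePoly_ne_zero_lac {k : ℕ} {c : ℕ → ℤ[X]} (hk : 1 ≤ k)
    (hcop : IsCoprime ((c 0).map (Int.castRingHom ℚ)) ((c k).map (Int.castRingHom ℚ))) (r : ℚ) :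
    C (aeval r (c k)) * X ^ k + C (aeval r (c 0)) ≠ (0 : ℚ[X]) := by
  intro h0
  have hk' : aeval r (c k) = 0 := by
    have h := congrArg (fun p : ℚ[X] => p.coeff k) h0
    simp only [coeff_add, coeff_C_mul, coeff_X_pow, if_true, mul_one, coeff_C, coeff_zero] at h
    rwa [if_neg (by omega), add_zero] at h
  have h0' : aeval r (c 0) = 0 := by
    have h := congrArg (fun p : ℚ[X] => p.coeff 0) h0
    simp only [coeff_add, coeff_C_mul, coeff_X_pow, coeff_C_zero, coeff_zero] at h
    rwa [if_neg (by omega), mul_zero, zero_add] at h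
  obtain ⟨a, b, hab⟩ := hcop
  have h := congrArg (eval r) hab
  rw [eval_add, eval_mul, eval_mul, eval_one, eval_map, eval_map, ← algebraMap_int_eq, ← aeval_def, ← aeval_def,
    hk', h0', mul_zero, mul_zero, add_zero] at h
  exact zero_ne_one h

/-- **THE ENGINE, SIEGEL FORM — FINITELY MANY ORDINATES OVER DYADIC ABSCISSAE** on a lacunary `xPolyP k c`,
`k ≥ 3`, when `c₀` is DOMINANT (`DomZero k c`), SEPARABLE over `ℚ` of degree `≥ 2` and COPRIME to `c_k`: the points
`(r, ξ·c_k(r))`, `ξ ∈ ℤ[1/2]`, are `T`-integral points of the SUPERELLIPTIC curve `y^k = c₀(r)·(−c_k(r)^{k−1})`,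
`T` = the primes of `2·lc(c₀)` — and the SUPERELLIPTIC SIEGEL THEOREM (§L, PROVED, `m = k ≥ 3`, `g = c₀`,
`h = −c_k^{k−1}`) leaves finitely many `r`. -/
theorem finite_ordinates_lac (k : ℕ) (c : ℕ → ℤ[X]) (hk : 3 ≤ k) (hlac : ∀ j, 1 ≤ j → j < k → c j = 0)
    (hdom : DomZero k c) (hsep : ((c 0).map (Int.castRingHom ℚ)).Separable) (hdeg : 2 ≤ (c 0).natDegree)
    (hcop : IsCoprime ((c 0).map (Int.castRingHom ℚ)) ((c k).map (Int.castRingHom ℚ))) :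
    {r : ℚ | ∃ ξ : ℚ, IsDyadic ξ ∧ bev (xPolyP k c) ξ r = 0}.Finite := by
  have hk1 : 1 ≤ k := by omega
  have hc₀ : c 0 ≠ 0 := ne_zero_of_domZero hk1 hdom
  set T : Set (HeightOneSpectrum (𝓞 ℚ)) := badT (c 0).leadingCoeff with hT_def
  have hT : T.Finite := badT_finite (leadingCoeff_ne_zero.mpr hc₀)
  set g : ℚ[X] := (c 0).map (Int.castRingHom ℚ) with hg_def
  set h : ℚ[X] := -((c k).map (Int.castRingHom ℚ)) ^ (k - 1) with hh_def
  have hg2 : 2 ≤ g.natDegree := by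
    rwa [hg_def, natDegree_map_eq_of_injective (Int.castRingHom ℚ).injective_int]
  have hgh : IsCoprime g h := hcop.pow_right.neg_right
  refine (finite_integer_pow_eq ℚ T hT hk g h hsep hg2 hgh).subset ?_
  rintro r ⟨ξ, hξ, hb⟩
  have h := ratEq_of_bev_lac hk1 hlac hb
  exact ⟨ordinate_mem_integer_lac hk1 hlac hdom hξ h, ξ * aeval r (c k), pow_eq_eval_lac hk1 h⟩

/-- **FINITELY MANY DYADIC ABSCISSAE** carrying a rational point of a lacunary dominant `xPolyP k c`
(each ordinate carries at most `k`: the fibre polynomial is non-zero by `fibrePoly_ne_zero_lac`). -/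
theorem finite_dyadicAbscissae_lac (k : ℕ) (c : ℕ → ℤ[X]) (hk : 3 ≤ k) (hlac : ∀ j, 1 ≤ j → j < k → c j = 0)
    (hdom : DomZero k c) (hsep : ((c 0).map (Int.castRingHom ℚ)).Separable) (hdeg : 2 ≤ (c 0).natDegree)
    (hcop : IsCoprime ((c 0).map (Int.castRingHom ℚ)) ((c k).map (Int.castRingHom ℚ))) :
    {ξ : ℚ | IsDyadic ξ ∧ ∃ r : ℚ, bev (xPolyP k c) ξ r = 0}.Finite := by
  have hk1 : 1 ≤ k := by omega
  have hR := finite_ordinates_lac k c hk hlac hdom hsep hdeg hcop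
  refine (hR.biUnion (t := fun r => {ξ : ℚ | IsRoot (C (aeval r (c k)) * X ^ k + C (aeval r (c 0))) ξ})
    fun r _ => Polynomial.finite_setOf_isRoot (fibrePoly_ne_zero_lac hk1 hcop r)).subset ?_
  rintro ξ ⟨hξ, r, h⟩
  refine Set.mem_biUnion (x := r) ⟨ξ, hξ, h⟩ ?_
  simp only [Set.mem_setOf_eq, IsRoot.def, eval_add, eval_mul, eval_C, eval_pow, eval_X]
  linear_combination ratEq_of_bev_lac hk1 hlac h

/-- **FINITELY MANY RATIONAL POINTS WITH DYADIC ABSCISSA** on a lacunary dominant `xPolyP k c`. -/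
theorem finite_dyadicPoints_lac (k : ℕ) (c : ℕ → ℤ[X]) (hk : 3 ≤ k) (hlac : ∀ j, 1 ≤ j → j < k → c j = 0)
    (hdom : DomZero k c) (hsep : ((c 0).map (Int.castRingHom ℚ)).Separable) (hdeg : 2 ≤ (c 0).natDegree)
    (hcop : IsCoprime ((c 0).map (Int.castRingHom ℚ)) ((c k).map (Int.castRingHom ℚ))) :
    {p : ℚ × ℚ | IsDyadic p.1 ∧ bev (xPolyP k c) p.1 p.2 = 0}.Finite :=
  ((finite_dyadicAbscissae_lac k c hk hlac hdom hsep hdeg hcop).prod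
    (finite_ordinates_lac k c hk hlac hdom hsep hdeg hcop)).subset fun p ⟨h1, h2⟩ => ⟨⟨h1, p.2, h2⟩, p.1, h1, h2⟩

/-- **`SiegelClause (xPolyP k c)`** (disjunct (A)) on the lacunary dominant class — PROVED. -/
theorem siegelClause_lac (k : ℕ) (c : ℕ → ℤ[X]) (hk : 3 ≤ k) (hlac : ∀ j, 1 ≤ j → j < k → c j = 0)
    (hdom : DomZero k c) (hsep : ((c 0).map (Int.castRingHom ℚ)).Separable) (hdeg : 2 ≤ (c 0).natDegree)
    (hcop : IsCoprime ((c 0).map (Int.castRingHom ℚ)) ((c k).map (Int.castRingHom ℚ))) :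
    SiegelClause (xPolyP k c) :=
  Or.inl (finite_dyadicAbscissae_lac k c hk hlac hdom hsep hdeg hcop)

/-- **`LevelFinite (xPolyP k c)`** — through the record's own door `levelFinite_of_siegelClause`. -/
theorem levelFinite_lac (k : ℕ) (c : ℕ → ℤ[X]) (hk : 3 ≤ k) (hlac : ∀ j, 1 ≤ j → j < k → c j = 0)
    (hdom : DomZero k c) (hsep : ((c 0).map (Int.castRingHom ℚ)).Separable) (hdeg : 2 ≤ (c 0).natDegree)
    (hcop : IsCoprime ((c 0).map (Int.castRingHom ℚ)) ((c k).map (Int.castRingHom ℚ))) :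
    LevelFinite (xPolyP k c) :=
  levelFinite_of_siegelClause (siegelClause_lac k c hk hlac hdom hsep hdeg hcop)

/-- **`ThinFibreAt m₀ (xPolyP k c)` AT EVERY QUALITY `m₀`** (in particular at the residual quality `m₀ = 2`). -/
theorem thinFibreAt_lac (k : ℕ) (c : ℕ → ℤ[X]) (hk : 3 ≤ k) (hlac : ∀ j, 1 ≤ j → j < k → c j = 0)
    (hdom : DomZero k c) (hsep : ((c 0).map (Int.castRingHom ℚ)).Separable) (hdeg : 2 ≤ (c 0).natDegree)
    (hcop : IsCoprime ((c 0).map (Int.castRingHom ℚ)) ((c k).map (Int.castRingHom ℚ))) (m₀ : ℕ) :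
    ThinFibreAt m₀ (xPolyP k c) :=
  thinFibreAt_of_levelFinite (levelFinite_lac k c hk hlac hdom hsep hdeg hcop) m₀

/-- `BddLevelEmpty (xPolyP k c)` (node 12's (b)). -/
theorem bddLevelEmpty_lac (k : ℕ) (c : ℕ → ℤ[X]) (hk : 3 ≤ k) (hlac : ∀ j, 1 ≤ j → j < k → c j = 0)
    (hdom : DomZero k c) (hsep : ((c 0).map (Int.castRingHom ℚ)).Separable) (hdeg : 2 ≤ (c 0).natDegree)
    (hcop : IsCoprime ((c 0).map (Int.castRingHom ℚ)) ((c k).map (Int.castRingHom ℚ))) :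
    BddLevelEmpty (xPolyP k c) :=
  (bddLevelEmpty_iff_levelFinite _).mpr (levelFinite_lac k c hk hlac hdom hsep hdeg hcop)

/-- **ALL BUT FINITELY MANY LEVELS CARRY NO RATIONAL POINT AT ALL**. -/
theorem finite_pointed_levels_lac (k : ℕ) (c : ℕ → ℤ[X]) (hk : 3 ≤ k) (hlac : ∀ j, 1 ≤ j → j < k → c j = 0)
    (hdom : DomZero k c) (hsep : ((c 0).map (Int.castRingHom ℚ)).Separable) (hdeg : 2 ≤ (c 0).natDegree)
    (hcop : IsCoprime ((c 0).map (Int.castRingHom ℚ)) ((c k).map (Int.castRingHom ℚ))) :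
    {N : ℕ | ∃ r : ℚ, bev (xPolyP k c) (partialSum 2 N) r = 0}.Finite :=
  (finite_levels_of_finite (finite_dyadicAbscissae_lac k c hk hlac hdom hsep hdeg hcop)).subset fun N ⟨r, h⟩ =>
    ⟨isDyadic_sQ N, r, by rwa [sQ_cast]⟩

/-! #### §E′  THE CLASS, INTRINSIC IN `P` (census convention, as node 15's `GaussAt` and node 23's `DomHyper`) -/

/-- [class] definition (census convention): **THE DOMINANT SUPERELLIPTIC (LACUNARY) CLASS `DomSuper P`** —
`x`-degree `k = xdeg P ≥ 3`; LACUNARITY `xCoeff P j = 0` for `0 < j < k` (`P = c_k(Y)·x^k + c₀(Y)`); DOMINANCE of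
`c₀ = xCoeff P 0` (the conjunct of node 15's `GaussAt`, verbatim); `c₀` SEPARABLE over `ℚ` of degree `≥ 2`; and
`c₀` COPRIME to `c_k = xCoeff P (xdeg P)` over `ℚ`.  NO slope condition, NO root condition, NO local datum. -/
def DomSuper (P : ℤ[X][X]) : Prop :=
  3 ≤ xdeg P ∧ (∀ j, 1 ≤ j → j < xdeg P → xCoeff P j = 0) ∧
    (∀ j, 1 ≤ j → j ≤ xdeg P → (xCoeff P j).natDegree < (xCoeff P 0).natDegree) ∧
    ((xCoeff P 0).map (Int.castRingHom ℚ)).Separable ∧ 2 ≤ (xCoeff P 0).natDegree ∧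
    IsCoprime ((xCoeff P 0).map (Int.castRingHom ℚ)) ((xCoeff P (xdeg P)).map (Int.castRingHom ℚ))

/-- **PRESENTATION LEMMA**: on `xPolyP k c` with a genuine top (`c k ≠ 0`),
`DomSuper ↔ 3 ≤ k ∧ lacunary ∧ DomZero k c ∧ c₀ separable over ℚ ∧ 2 ≤ deg c₀ ∧ IsCoprime c₀ c_k`. -/
theorem domSuper_xPolyP_iff (k : ℕ) (c : ℕ → ℤ[X]) (hck : c k ≠ 0) :
    DomSuper (xPolyP k c) ↔
      3 ≤ k ∧ (∀ j, 1 ≤ j → j < k → c j = 0) ∧ DomZero k c ∧ ((c 0).map (Int.castRingHom ℚ)).Separable ∧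
        2 ≤ (c 0).natDegree ∧ IsCoprime ((c 0).map (Int.castRingHom ℚ)) ((c k).map (Int.castRingHom ℚ)) := by
  have hx := xdeg_xPolyP k c hck
  have hc : ∀ j, j ≤ k → xCoeff (xPolyP k c) j = c j := fun j hj => by rw [xCoeff_xPolyP, if_pos hj]
  rw [DomSuper, hx, hc 0 (Nat.zero_le _), hc k le_rfl]
  constructor
  · rintro ⟨hk, hl, hd, hs, hdeg, hcop⟩
    exact ⟨hk, fun j hj1 hj2 => (hc j hj2.le).symm.trans (hl j hj1 hj2),
      fun j hj1 hj2 => (hc j hj2) ▸ hd j hj1 hj2, hs, hdeg, hcop⟩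
  · rintro ⟨hk, hl, hd, hs, hdeg, hcop⟩
    exact ⟨hk, fun j hj1 hj2 => (hc j hj2.le).trans (hl j hj1 hj2),
      fun j hj1 hj2 => (hc j hj2).symm ▸ hd j hj1 hj2, hs, hdeg, hcop⟩

/-- a member of the class in presentation form: `P = xPolyP (xdeg P) (xCoeff P)` with the presentation hypotheses. -/
theorem DomSuper.presentation {P : ℤ[X][X]} (h : DomSuper P) :
    P = xPolyP (xdeg P) (xCoeff P) ∧ 3 ≤ xdeg P ∧ (∀ j, 1 ≤ j → j < xdeg P → xCoeff P j = 0) ∧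
      DomZero (xdeg P) (xCoeff P) ∧ ((xCoeff P 0).map (Int.castRingHom ℚ)).Separable ∧
      2 ≤ (xCoeff P 0).natDegree ∧
      IsCoprime ((xCoeff P 0).map (Int.castRingHom ℚ)) ((xCoeff P (xdeg P)).map (Int.castRingHom ℚ)) :=
  ⟨(xPolyP_xCoeff P).symm, h⟩

/-- **THE THEOREM (node 24): `DomSuper P → ThinFibreAt m₀ P` at EVERY quality `m₀`** — hypothesis-free. -/
theorem thinFibreAt_of_domSuper {P : ℤ[X][X]} (h : DomSuper P) (m₀ : ℕ) : ThinFibreAt m₀ P := by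
  obtain ⟨hP, hk, hl, hd, hs, hdeg, hcop⟩ := h.presentation
  rw [hP]
  exact thinFibreAt_lac _ _ hk hl hd hs hdeg hcop m₀

/-- `DomSuper P → LevelFinite P`. -/
theorem levelFinite_of_domSuper {P : ℤ[X][X]} (h : DomSuper P) : LevelFinite P := by
  obtain ⟨hP, hk, hl, hd, hs, hdeg, hcop⟩ := h.presentation
  rw [hP]
  exact levelFinite_lac _ _ hk hl hd hs hdeg hcop

/-- `DomSuper P → SiegelClause P` (disjunct (A): the record's residual binder, PROVED on the class). -/
theorem siegelClause_of_domSuper {P : ℤ[X][X]} (h : DomSuper P) : SiegelClause P := by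
  obtain ⟨hP, hk, hl, hd, hs, hdeg, hcop⟩ := h.presentation
  rw [hP]
  exact siegelClause_lac _ _ hk hl hd hs hdeg hcop

/-- `DomSuper P → BddLevelEmpty P`. -/
theorem bddLevelEmpty_of_domSuper {P : ℤ[X][X]} (h : DomSuper P) : BddLevelEmpty P :=
  (bddLevelEmpty_iff_levelFinite _).mpr (levelFinite_of_domSuper h)

/-- `DomSuper P →` all but finitely many levels of `P` carry no rational point at all. -/
theorem finite_pointed_levels_of_domSuper {P : ℤ[X][X]} (h : DomSuper P) :
    {N : ℕ | ∃ r : ℚ, bev P (partialSum 2 N) r = 0}.Finite := by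
  obtain ⟨hP, hk, hl, hd, hs, hdeg, hcop⟩ := h.presentation
  rw [hP]
  exact finite_pointed_levels_lac _ _ hk hl hd hs hdeg hcop

/-- `DomSuper P →` finitely many rational points of `P` with dyadic abscissa. -/
theorem finite_dyadicPoints_of_domSuper {P : ℤ[X][X]} (h : DomSuper P) :
    {p : ℚ × ℚ | IsDyadic p.1 ∧ bev P p.1 p.2 = 0}.Finite := by
  obtain ⟨hP, hk, hl, hd, hs, hdeg, hcop⟩ := h.presentation
  rw [hP]
  exact finite_dyadicPoints_lac _ _ hk hl hd hs hdeg hcop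

/-- the LACUNARITY conjunct, typed reading: **A MIDDLE TERM KILLS MEMBERSHIP** (`xCoeff P 1 = 0` on the class; the
dominant-far standing witness `X3 = x³ + Y·x + Y⁷` has `xCoeff 1 = Y ≠ 0` — Probe). -/
theorem DomSuper.xCoeff_one_eq_zero {P : ℤ[X][X]} (h : DomSuper P) : xCoeff P 1 = 0 :=
  h.2.1 1 le_rfl (by have := h.1; omega)

/-- **`x`-DEGREE `≤ 2` KILLS MEMBERSHIP**: no `xPolyP 2 c` is in the class (node 23's `M j`, `W4P`, `CB`, `VW`, `SW`,
`dsP`, `quinticP` are all of this form — refused BY TYPE). -/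
theorem not_domSuper_xPolyP_two (c : ℕ → ℤ[X]) : ¬ DomSuper (xPolyP 2 c) := fun h => by
  have h3 := h.1
  have h2 := xdeg_xPolyP_le 2 c
  omega

/-! #### §E″  THE TWO-TERM PRESENTATION `x^k·B(Y) − A(Y)` (node 13½'s `twoTermP`): the class on two-term curves -/

/-- [datum] the `x`-coefficients of the two-term curve `twoTermP k B A = x^k·B(Y) − A(Y)`: `c_k = B`, `c₀ = −A`,
all others `0`. -/
def twoTermC (k : ℕ) (B A : ℤ[X]) : ℕ → ℤ[X] := fun i => if i = k then B else if i = 0 then -A else 0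

/-- `(k : ℕ) (B A : ℤ[X]) : twoTermC k B A k = B`. -/
@[simp] theorem twoTermC_top (k : ℕ) (B A : ℤ[X]) : twoTermC k B A k = B := by simp [twoTermC]
/-- `{k : ℕ} (hk : k ≠ 0) (B A : ℤ[X]) : twoTermC k B A 0 = -A`. -/
theorem twoTermC_zero {k : ℕ} (hk : k ≠ 0) (B A : ℤ[X]) : twoTermC k B A 0 = -A := by
  simp [twoTermC, hk.symm]
/-- `{k : ℕ} {B A : ℤ[X]} {i : ℕ} (hik : i ≠ k) (hi0 : i ≠ 0) : twoTermC k B A i = 0`. -/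
theorem twoTermC_of_ne {k : ℕ} {B A : ℤ[X]} {i : ℕ} (hik : i ≠ k) (hi0 : i ≠ 0) : twoTermC k B A i = 0 := by
  simp [twoTermC, hik, hi0]

/-- **THE TWO-TERM CURVE IS AN `xPolyP`**: `twoTermP k B A = xPolyP k (twoTermC k B A)` (`k ≥ 1`). -/
theorem twoTermP_eq_xPolyP {k : ℕ} (hk : 1 ≤ k) (B A : ℤ[X]) : twoTermP k B A = xPolyP k (twoTermC k B A) := by
  ext i i'
  rw [coeff_coeff_xPolyP, coeff_coeff_twoTermP]
  by_cases h1 : i' = k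
  · subst h1
    rw [if_pos rfl, if_neg (by omega), if_pos (Finset.mem_range.mpr (Nat.lt_succ_self _)), twoTermC_top, sub_zero]
  · by_cases h0 : i' = 0
    · subst h0
      rw [if_neg h1, if_pos rfl, if_pos (Finset.mem_range.mpr (by omega)), twoTermC_zero (Ne.symm h1), coeff_neg,
        zero_sub]
    · rw [if_neg h1, if_neg h0, twoTermC_of_ne h1 h0, coeff_zero, sub_zero, ite_self]

/-- **THE CLASS ON TWO-TERM CURVES**: for `k ≥ 1` and `B ≠ 0`,
`DomSuper (x^k·B − A) ↔ 3 ≤ k ∧ deg B < deg A ∧ A separable over ℚ ∧ 2 ≤ deg A ∧ IsCoprime A B (over ℚ)` —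
where node 13½'s ladder `thinFibreAt_twoTermP` needs `deg < k·m₀`, the class needs NO inequality in `m₀`. -/
theorem domSuper_twoTermP_iff {k : ℕ} (hk : 1 ≤ k) {B : ℤ[X]} (hB : B ≠ 0) (A : ℤ[X]) :
    DomSuper (twoTermP k B A) ↔ 3 ≤ k ∧ B.natDegree < A.natDegree ∧ (A.map (Int.castRingHom ℚ)).Separable ∧
      2 ≤ A.natDegree ∧ IsCoprime (A.map (Int.castRingHom ℚ)) (B.map (Int.castRingHom ℚ)) := by
  have hk0 : k ≠ 0 := by omega
  have htop : twoTermC k B A k ≠ 0 := by rwa [twoTermC_top]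
  rw [twoTermP_eq_xPolyP hk, domSuper_xPolyP_iff k _ htop, twoTermC_top, twoTermC_zero hk0, Polynomial.map_neg,
    natDegree_neg, IsCoprime.neg_left_iff]
  constructor
  · rintro ⟨h3, -, hd, hs, h2, hc⟩
    refine ⟨h3, ?_, hs.of_dvd (dvd_neg.mpr dvd_rfl), h2, hc⟩
    have := hd k hk le_rfl
    rwa [twoTermC_top, twoTermC_zero hk0, natDegree_neg] at this
  · rintro ⟨h3, hd, hs, h2, hc⟩
    refine ⟨h3, fun j hj1 hj2 => twoTermC_of_ne (by omega) (by omega), fun j hj1 hj2 => ?_,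
      hs.of_dvd (neg_dvd.mpr dvd_rfl), h2, hc⟩
    rw [twoTermC_zero hk0, natDegree_neg]
    rcases Nat.lt_or_ge j k with hjk | hjk
    · rw [twoTermC_of_ne (by omega) (by omega), natDegree_zero]; omega
    · rw [show j = k by omega, twoTermC_top]; exact hd

/-- **THE THEOREM ON TWO-TERM CURVES: `ThinFibreAt m₀ (x^k·B(Y) − A(Y))` at EVERY `m₀`** for `k ≥ 3`, `B ≠ 0`,
`deg B < deg A`, `A` separable of degree `≥ 2` and coprime to `B` over `ℚ` — NO inequality `deg < k·m₀`. -/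
theorem thinFibreAt_twoTermP_dom {k : ℕ} (hk : 3 ≤ k) {B : ℤ[X]} (hB : B ≠ 0) {A : ℤ[X]}
    (hd : B.natDegree < A.natDegree) (hs : (A.map (Int.castRingHom ℚ)).Separable) (h2 : 2 ≤ A.natDegree)
    (hc : IsCoprime (A.map (Int.castRingHom ℚ)) (B.map (Int.castRingHom ℚ))) (m₀ : ℕ) :
    ThinFibreAt m₀ (twoTermP k B A) :=
  thinFibreAt_of_domSuper ((domSuper_twoTermP_iff (by omega) hB A).mpr ⟨hk, hd, hs, h2, hc⟩) m₀

/-- `LevelFinite (x^k·B(Y) − A(Y))` under the same hypotheses. -/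
theorem levelFinite_twoTermP_dom {k : ℕ} (hk : 3 ≤ k) {B : ℤ[X]} (hB : B ≠ 0) {A : ℤ[X]}
    (hd : B.natDegree < A.natDegree) (hs : (A.map (Int.castRingHom ℚ)).Separable) (h2 : 2 ≤ A.natDegree)
    (hc : IsCoprime (A.map (Int.castRingHom ℚ)) (B.map (Int.castRingHom ℚ))) : LevelFinite (twoTermP k B A) :=
  levelFinite_of_domSuper ((domSuper_twoTermP_iff (by omega) hB A).mpr ⟨hk, hd, hs, h2, hc⟩)

/-- **DISJOINTNESS FROM NODE 23's CLASS**: `DomSuper P → ¬ DomHyper P` (`xdeg P ≥ 3` versus `xdeg P = 2`). -/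
theorem not_domHyper_of_domSuper {P : ℤ[X][X]} (h : DomSuper P) : ¬ DomHyper P := fun hH => by
  have h3 := h.1
  rw [hH.1] at h3
  exact absurd h3 (by norm_num)

end Engine

end Summit.Schanuel.Schanuel.Theorems.RootDecomp1KSuperellipticSiegel

end
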